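import Summits.QuantumFields.YangMills.Theorems.BalabanUVNodesN15PerCubeGreenKnit335
import Summits.QuantumFields.YangMills.Theorems.BalabanUVNodesN15PerCubeGreenInstance
import HarnessLib

/-!
# N15 = NE2, road (c) — PROGRAMME (PC), (PC-F) «the per-cube KNIT», V: THE SMALL-DATA EDITION — n15-c∕319's seven numeric thresholds are JOINTLY SATISFIABLE, UNIFORMLY IN THE COVER INDEX:
# decay + two-sided inverse for EVERY `U` in the per-cube class (3.35) with `C∕ξ, C∕ξ² ≤ ε₀(e)` on scales `L^m ≥ w₂(e)` (dag-n15-c g30, n15-c∕320)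

Cell `pub-ymgap`, seat `pub-ymgap-dag-n15-c` (generation g30; R134 (a), s1; HUMAN RULING D-0062).  `bears_on: R4∕N15 · K3⁸ SpineGivenEndpointR13SepCoPHV (stmt-QuantumFields-27366)`;
filed `--kind proof --supports stmt-QuantumFields-27366 --as helper` — COUNT-NEUTRAL.  Two theorems, 0 `def`, 0 `sorry`; ε-bookkeeping over n15-c∕319, no new estimate.  Imports BY NAME n15-c∕319
`…PerCubeGreenKnit335` (★★★★ `cvP_cvGlued_spec_perCube335`) and n15-c∕267 `…PerCubeGreenInstance` (`sigma_le_of_small`: `(1 + r n⁻¹)^{cn} − 1 ≤ 2cr ≤ 1`); King's `aK_le`∕`aK_pos`.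
Nothing in the tree is modified.

WHY ((PC-F) closed honestly).  n15-c∕319 displays seven numeric inequalities between the (3.35) letters `ξ, C`, the species letter `r_V`, the near∕far letter `R_N` and the knit's
existential constants; several of them carry the cover index `k` (`η = L^{−k}`, `σ_k = (1 + r_V η)^{(d+1)L^k} − 1`, `K_k = (1 + ρη)^{(d+2)L^k} − 1`, King's `a_K`) and the scale `w = L^m`.
A knit whose thresholds could only be met k by k would be vacuous as a UV statement.  THIS FILE shows they are met UNIFORMLY: `σ_k ≤ 2(d+1)r_V`, `K_k ≤ 2(d+2)ρL^k = 2(d+2)|ι|Y`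
(`Y` = the one-bond letter, `≤ Q_e·C∕ξ` since `e^{ηC∕ξ} ≤ e ≤ 3`), `a_K ≤ a₀`, `w⁻¹ + 2e^{−δ_R w} ≤ (1 + 2∕δ_R)∕w`; so with `R_N := min θ₀ (R₀∕2)`, `r_V := min (1∕(2(d+1))) (T∕(3(B_R+1)K_σ))`
(`T = min R_N R₁`), `ε₀(e) := min 1 (1∕(2(d+2)|ι|Q_e + 1)) (r_V∕P_e) (R_N∕(3K_q))` and `w₂ := max w₀ 1 (3(B_R+1)(1+2∕δ_R)∕T)` every threshold holds whenever `C∕ξ ≤ ε₀`, `C∕ξ² ≤ ε₀`,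
`L^m ≥ w₂` — for EVERY `k ≥ 1`.  (`ε₀, w₂` depend on the coordinate system `e` through dag-n15-w2's `κ_e` and on `m = |mm|`, as the letters do; the decay constants `δ, B` do not.)

WHAT.  §1 `pow_mul_sub_one_le_of_small` (n15-c∕267's `sigma_le_of_small` with a general multiplier).  §2 ★★★★ `cvP_cvGlued_spec_perCube335_small` — for odd `L ≥ 17`, `a₀, a > 0`, colour `ι`: `∃ δ B > 0`, for all trace-form coordinates `e` of `M_m(ℂ)` (`m ≥ 1`): `∃ ε₀ > 0, w₂` such that
on every doubled torus of the cover with `k ≥ 1`, `L^m ≥ w₂`, for EVERY unitary site field `U`, letters `ξ, C > 0` with `C∕ξ ≤ ε₀`, `C∕ξ² ≤ ε₀`, and unitary cube gauges `w_k` with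
potentials `A_k` on the locality boxes (`U^{w_k} = e^{iηA_k}`, `‖A_k‖ < C∕ξ`, `‖η⁻¹∇^ηA_k‖ < C∕ξ²` — the per-cube (3.35) datum, NOTHING ELSE): the glued operator of the dressed smooth-cut
cubes in the gauges `w_k` is `≤ B·e^{−(δ∕16)|y−y′|_T}` blockwise AND the two-sided inverse of `Δ_{R_U} + a·Q*(U)Q(U) − D_U(I−R(U))D*_U`.

HONEST FRAMING ∕ LIMITS.  MODEL carriers and operator as n15-c∕319 (doubled-torus cover, one averaging level, uniform weights in `Δ′_a`, one-level staircases, `Q(U)` = main term (125) of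
[Balaban1985Averaging] (124), component-blind site gauges, crude constants); the gauges∕potentials are a DATUM per cube (the print's ∃ in (3.35) is the caller's; produced from r06's
`Reg335Cube` elsewhere in the lane).  This is the per-cube-class analogue, in the model, of [Balaban1985BackgroundPropagators] Thm 3.1∕3.3's HYPOTHESIS SHAPE «for U satisfying (3.35)
with Mα₀ small»; it is NOT Thm 3.1∕3.3 AS PRINTED (model operator∕class∕carriers; no `L^j`-tower of (3.35) scales, one `ξ`).  NE2⁺ NOT PRINTED, NOT proved; N15 of record untouched
(DISCHARGED AS CONSUMED, p687738) — no re-pin, nothing re-claimed; K3⁸ OPEN; counts UNMOVED (typed 28∕28); one finite 𝕋⁴ at fixed ε per index — NOT infinite volume, NOT OS on ℝ⁴, NOT a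
mass gap, NOT Clay.  Restate-immune (no Theses import).
-/

noncomputable section

open scoped BigOperators Matrix Matrix.Norms.L2Operator

namespace Summit.QuantumFields.YangMills.BalabanUVNodes.N15.Gluing

open Real
open Literature.MathematicalPhysics.QuantumFieldTheory.Balaban1983to89
open Literature.MathematicalPhysics.QuantumFieldTheory.Balaban1983to89.B5Prop11Plancherel (Tor fine unitVec)
open Literature.MathematicalPhysics.QuantumFieldTheory.Balaban1983to89.B11SectG (BlockNorm HasMaj)
open Literature.MathematicalPhysics.QuantumFieldTheory.Balaban1983to89.B6Prop26Gluing (mulOp)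
open Literature.MathematicalPhysics.QuantumFieldTheory.Balaban1983to89.B6UnitTorusCarrier (unitTorusGeo)
open Literature.MathematicalPhysics.QuantumFieldTheory.Balaban1983to89.B9Eq3117Current (gaugeTr)
open Literature.MathematicalPhysics.QuantumFieldTheory.Balaban1983to89.B9Eq39Adjoint (covD fluct)
open Literature.MathematicalPhysics.QuantumFieldTheory.King1986 (aK aK_pos aK_le)
open Literature.MathematicalPhysics.QuantumFieldTheory.King1986.Torus (blockOf)
open Literature.Barriers.QuantumFields (traceForm)
open Summit.QuantumFields.YangMills.BalabanUVNodes.N15.BackgroundLayer (covLapM)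
open Summit.QuantumFields.YangMills.BalabanUVNodes.N15.VectorPiece (bshiftEquiv)
open Summit.QuantumFields.YangMills.BalabanUVNodes.N15.MatrixSpecies (coordMat basisConst basisConst_nonneg)
open Summit.QuantumFields.YangMills.BalabanUVNodes.N15.TwoGrid (cubeBlocks)
open Summit.QuantumFields.YangMills.BalabanUVNodes.N15.CurvedSpecies (gaugePair)

variable {d : ℕ} {L : ℕ} [NeZero L]

/-! ## §1 `(1 + r n⁻¹)^{cn} − 1 ≤ 2cr ≤ 1` -/

/-- `(1 + r n⁻¹)^{cn} − 1` lies in `[0, 2cr] ⊆ [0, 1]` as soon as `0 ≤ r`, `2cr ≤ 1` (n15-c∕267 `sigma_le_of_small` with a general multiplier `c`: `1 + t ≤ e^t`, `|e^x − 1| ≤ 2|x|` on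
`|x| ≤ 1`). [folklore] -/
theorem pow_mul_sub_one_le_of_small (c n : ℕ) (hn : 0 < n) {r : ℝ} (hr : 0 ≤ r) (hr1 : 2 * (c : ℝ) * r ≤ 1) :
    0 ≤ (1 + r * ((n : ℝ))⁻¹) ^ (c * n) - 1 ∧ (1 + r * ((n : ℝ))⁻¹) ^ (c * n) - 1 ≤ 2 * ((c : ℝ) * r) ∧ (1 + r * ((n : ℝ))⁻¹) ^ (c * n) - 1 ≤ 1 := by
  have hnr : (0 : ℝ) < n := by exact_mod_cast hn
  have hc : (0 : ℝ) ≤ c := by positivity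
  have ht : 0 ≤ r * ((n : ℝ))⁻¹ := by positivity
  have h0 : 0 ≤ (1 + r * ((n : ℝ))⁻¹) ^ (c * n) - 1 := by
    have := one_le_pow₀ (M₀ := ℝ) (a := 1 + r * ((n : ℝ))⁻¹) (by linarith) (n := c * n); linarith
  have hexp : (1 + r * ((n : ℝ))⁻¹) ^ (c * n) ≤ Real.exp ((c : ℝ) * r) := by
    have h1 : 1 + r * ((n : ℝ))⁻¹ ≤ Real.exp (r * ((n : ℝ))⁻¹) := by have := Real.add_one_le_exp (r * ((n : ℝ))⁻¹); linarith
    calc (1 + r * ((n : ℝ))⁻¹) ^ (c * n) ≤ (Real.exp (r * ((n : ℝ))⁻¹)) ^ (c * n) := pow_le_pow_left₀ (by linarith) h1 _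
      _ = Real.exp ((((c * n : ℕ)) : ℝ) * (r * ((n : ℝ))⁻¹)) := (Real.exp_nat_mul _ _).symm
      _ = Real.exp ((c : ℝ) * r) := by congr 1; push_cast; field_simp
  have hx : |(c : ℝ) * r| ≤ 1 := by rw [abs_of_nonneg (by positivity)]; linarith
  have h2 := Real.abs_exp_sub_one_le hx
  rw [abs_of_nonneg (by positivity : (0 : ℝ) ≤ (c : ℝ) * r)] at h2
  have h3 : Real.exp ((c : ℝ) * r) - 1 ≤ 2 * ((c : ℝ) * r) := (le_abs_self _).trans h2
  exact ⟨h0, by linarith, by linarith⟩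

/-! ## §2 The small-data edition of n15-c∕319 -/

set_option maxHeartbeats 800000 in
/-- ★★★★ **THE KNIT IN PER-CUBE GAUGES (3.35), SMALL-DATA EDITION — NO NUMERIC SIDE CONDITIONS BEYOND `C∕ξ, C∕ξ² ≤ ε₀(e)`, `L^m ≥ w₂(e)`.**  For odd `L ≥ 17`, `a₀, a > 0`, colour `ι`:
`∃ δ B > 0` such that for all trace-form coordinates `e` of `M_m(ℂ)` there are `ε₀ > 0`, `w₂` with: on every doubled torus of the cover (`k ≥ 1`, `L^m ≥ w₂`), for EVERY unitary site field
`U`, (3.35) letters `ξ, C > 0` with `C∕ξ ≤ ε₀`, `C∕ξ² ≤ ε₀`, unitary cube gauges `w_k` with potentials on `c(Lw+6w−m₀,k)+[0,Lw+16w+2)^{d+1}`, the glued operator of the dressed smooth-cut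
cubes in the gauges `w_k` is `≤ B·e^{−(δ∕16)d}` blockwise AND the two-sided inverse of `Δ_{R_U} + a·Q*(U)Q(U) − D_U(I−R(U))D*_U` (n15-c∕319 with its seven thresholds DISCHARGED
uniformly in `k`).  MODEL; NOT [B9] Thm 3.1∕3.3 as printed.
[cite: Balaban1985BackgroundPropagators, (3.35) p.396, Thm 3.1 p.397 and Thm 3.3 p.399 (shape: «for U satisfying (3.35)», «Mα₀ sufficiently small»), (3.26) p.395, (3.49) p.399, (3.59)–(3.65) pp.402–403, Cor. 3.8 p.410; Balaban1984PropagatorsII, (2.91)–(2.93) p.239] -/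
theorem cvP_cvGlued_spec_perCube335_small (hL : Odd L ∧ 1 < L) (hL17 : 17 ≤ L) {a₀ : ℝ} (ha₀ : 0 < a₀) {a : ℝ} (ha : 0 < a) (ι : Type) [Fintype ι] [DecidableEq ι] :
    ∃ δ B : ℝ, 0 < δ ∧ 0 < B ∧
      ∀ {mm : Type} [Fintype mm] [DecidableEq mm] [Nonempty mm] (e : Matrix mm mm ℂ ≃L[ℝ] (ι → ℝ)), (∀ A B : Matrix mm mm ℂ, traceForm A B = e A ⬝ᵥ e B) →
      ∃ ε₀ w₂ : ℝ, 0 < ε₀ ∧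
      ∀ (mv kk : ℕ), 1 ≤ kk → w₂ ≤ ((L ^ mv : ℕ) : ℝ) →
      ∀ (U : Fin (d + 1) → ScX d L mv kk hL → (Matrix mm mm ℂ)ˣ), (∀ μ x, (U μ x : Matrix mm mm ℂ) ∈ Matrix.unitaryGroup mm ℂ) →
      ∀ (ξ C : ℝ), 0 < ξ → 0 < C → C / ξ ≤ ε₀ → C / ξ ^ 2 ≤ ε₀ →
      ∀ (w : (Fin (d + 1) → ZMod (2 * L)) → ScX d L mv kk hL → (Matrix mm mm ℂ)ˣ), (∀ k x, (w k x : Matrix mm mm ℂ) ∈ Matrix.unitaryGroup mm ℂ) →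
        (∀ k : Fin (d + 1) → ZMod (2 * L), ∃ A : Fin (d + 1) → ScX d L mv kk hL → Matrix mm mm ℂ,
          (∀ μ, ∀ z ∈ {x : ScX d L mv kk hL | blockOf (L ^ kk) (cvM d L mv kk hL) x ∈ cubeBlocks (cvM d L mv kk hL) (coverCorner (cvM d L mv kk hL) (L ^ mv) L (L * L ^ mv + 6 * L ^ mv - coverMargin L mv) k) (L * L ^ mv + 16 * L ^ mv + 2)}, gaugeTr (scShift d L mv kk hL) (w k) U μ z = fluct (((((L ^ kk : ℕ) : ℝ))⁻¹)) A μ z) ∧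
          (∀ μ, ∀ z ∈ {x : ScX d L mv kk hL | blockOf (L ^ kk) (cvM d L mv kk hL) x ∈ cubeBlocks (cvM d L mv kk hL) (coverCorner (cvM d L mv kk hL) (L ^ mv) L (L * L ^ mv + 6 * L ^ mv - coverMargin L mv) k) (L * L ^ mv + 16 * L ^ mv + 2)}, ‖A μ z‖ < C * ξ⁻¹) ∧
          (∀ μ ν, ∀ z ∈ {x : ScX d L mv kk hL | blockOf (L ^ kk) (cvM d L mv kk hL) x ∈ cubeBlocks (cvM d L mv kk hL) (coverCorner (cvM d L mv kk hL) (L ^ mv) L (L * L ^ mv + 6 * L ^ mv - coverMargin L mv) k) (L * L ^ mv + 16 * L ^ mv + 2)}, ‖((↑(((((L ^ kk : ℕ) : ℝ))⁻¹)) : ℂ)⁻¹) • covD (scShift d L mv kk hL) (fun _ _ => (1 : (Matrix mm mm ℂ)ˣ)) μ (A ν) z‖ < C * (ξ ^ 2)⁻¹)) →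
        HasMaj (CvNorm d L mv kk hL ι) (CvNorm d L mv kk hL ι) (cvGlued d L mv kk hL a ((((L ^ kk : ℕ) : ℝ))⁻¹) ι e (fun k (p : CvX d L mv kk hL) => (w k p.1 : Matrix mm mm ℂ)) (fun μ x => (U μ x.1 : Matrix mm mm ℂ)) (cvNL d L mv kk hL a ι - cvNVq d L mv kk hL a ι e (fun μ x => (U μ x.1 : Matrix mm mm ℂ)) - cvNVr d L mv kk hL a ι e (fun μ x => (U μ x.1 : Matrix mm mm ℂ))) (fun k => (cvNVq d L mv kk hL a ι e (cvGauge d L mv kk hL (fun p => (w k p.1 : Matrix mm mm ℂ)) (fun μ x => (U μ x.1 : Matrix mm mm ℂ))) + cvNVr d L mv kk hL a ι e (cvGauge d L mv kk hL (fun p => (w k p.1 : Matrix mm mm ℂ)) (fun μ x => (U μ x.1 : Matrix mm mm ℂ))))))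
          (fun y y' => B * Real.exp (-(δ / 16 * (unitTorusGeo L kk (cvM d L mv kk hL)).dist y y'))) ∧
        (cvGlued d L mv kk hL a ((((L ^ kk : ℕ) : ℝ))⁻¹) ι e (fun k (p : CvX d L mv kk hL) => (w k p.1 : Matrix mm mm ℂ)) (fun μ x => (U μ x.1 : Matrix mm mm ℂ)) (cvNL d L mv kk hL a ι - cvNVq d L mv kk hL a ι e (fun μ x => (U μ x.1 : Matrix mm mm ℂ)) - cvNVr d L mv kk hL a ι e (fun μ x => (U μ x.1 : Matrix mm mm ℂ))) (fun k => (cvNVq d L mv kk hL a ι e (cvGauge d L mv kk hL (fun p => (w k p.1 : Matrix mm mm ℂ)) (fun μ x => (U μ x.1 : Matrix mm mm ℂ))) + cvNVr d L mv kk hL a ι e (cvGauge d L mv kk hL (fun p => (w k p.1 : Matrix mm mm ℂ)) (fun μ x => (U μ x.1 : Matrix mm mm ℂ))))) ∘ₗ (covLapM (bshiftEquiv (cvM d L mv kk hL) (L ^ kk)) ((((L ^ kk : ℕ) : ℝ))⁻¹) (gaugePair (bshiftEquiv (cvM d L mv kk hL) (L ^ kk)) (fun μ x => coordMat e (ContinuousLinearMap.mulLeftRight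 ℝ (Matrix mm mm ℂ) ((U μ x.1 : Matrix mm mm ℂ)) ((U μ x.1 : Matrix mm mm ℂ))ᴴ))) + (cvNL d L mv kk hL a ι - cvNVq d L mv kk hL a ι e (fun μ x => (U μ x.1 : Matrix mm mm ℂ)) - cvNVr d L mv kk hL a ι e (fun μ x => (U μ x.1 : Matrix mm mm ℂ)))) = LinearMap.id ∧
          (covLapM (bshiftEquiv (cvM d L mv kk hL) (L ^ kk)) ((((L ^ kk : ℕ) : ℝ))⁻¹) (gaugePair (bshiftEquiv (cvM d L mv kk hL) (L ^ kk)) (fun μ x => coordMat e (ContinuousLinearMap.mulLeftRight ℝ (Matrix mm mm ℂ) ((U μ x.1 : Matrix mm mm ℂ)) ((U μ x.1 : Matrix mm mm ℂ))ᴴ))) + (cvNL d L mv kk hL a ι - cvNVq d L mv kk hL a ι e (fun μ x => (U μ x.1 : Matrix mm mm ℂ)) - cvNVr d L mv kk hL a ι e (fun μ x => (U μ x.1 : Matrix mm mm ℂ)))) ∘ₗ cvGlued d L mv kk hL a ((((L ^ kk : ℕ) : ℝ))⁻¹) ι e (fun k (p : CvX d L mv kk hL) => (w k p.1 : Matrix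 mm mm ℂ)) (fun μ x => (U μ x.1 : Matrix mm mm ℂ)) (cvNL d L mv kk hL a ι - cvNVq d L mv kk hL a ι e (fun μ x => (U μ x.1 : Matrix mm mm ℂ)) - cvNVr d L mv kk hL a ι e (fun μ x => (U μ x.1 : Matrix mm mm ℂ))) (fun k => (cvNVq d L mv kk hL a ι e (cvGauge d L mv kk hL (fun p => (w k p.1 : Matrix mm mm ℂ)) (fun μ x => (U μ x.1 : Matrix mm mm ℂ))) + cvNVr d L mv kk hL a ι e (cvGauge d L mv kk hL (fun p => (w k p.1 : Matrix mm mm ℂ)) (fun μ x => (U μ x.1 : Matrix mm mm ℂ))))) = LinearMap.id) := by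
  obtain ⟨δ, δR, w₀, R₀, R₁, θ₀, B, BR, Bq, hδ, hδle, hR₀, hR₁, hθ₀, hB, hBR, hBq, H⟩ := cvP_cvGlued_spec_perCube335 (d := d) hL hL17 ha₀ ha ι
  refine ⟨δ, B, hδ, hB, fun {mm} _ _ _ e he => ?_⟩
  have hL1r : (1 : ℝ) < (L : ℝ) := by exact_mod_cast hL.2
  have hδR : 0 < δR := lt_of_lt_of_le hδ hδle
  have hI0 : (0 : ℝ) ≤ (Fintype.card ι : ℝ) := by positivity
  have hJc0 : (0 : ℝ) ≤ (Fintype.card (Fin (d + 1)) : ℝ) := by positivity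
  have hJ20 : (0 : ℝ) < (1 + Fintype.card (Fin (d + 1) ⊕ Fin (d + 1))) := by positivity
  have hDd0 : (0 : ℝ) < (2 * ((d : ℝ) + 1)) := by positivity
  have hD20 : (0 : ℝ) < (2 * ((d : ℝ) + 2)) := by positivity
  have hκ0 : 0 ≤ @basisConst ι _ (Matrix mm mm ℂ) Matrix.frobeniusNormedAddCommGroup Matrix.frobeniusNormedSpace e := @basisConst_nonneg ι _ (Matrix mm mm ℂ) Matrix.frobeniusNormedAddCommGroup Matrix.frobeniusNormedSpace e
  have hg0 : 0 ≤ @basisConst ι _ (Matrix mm mm ℂ) Matrix.frobeniusNormedAddCommGroup Matrix.frobeniusNormedSpace e * (2 * Real.sqrt (Fintype.card mm)) := by positivity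
  -- the k-free letters (opaque abbreviations with their defining equations)
  obtain ⟨RN, hRN⟩ : ∃ RN : ℝ, RN = min θ₀ (R₀ / 2) := ⟨_, rfl⟩
  have hRN0 : 0 < RN := by rw [hRN]; exact lt_min hθ₀ (by positivity)
  have hRNθ : RN ≤ θ₀ := by rw [hRN]; exact min_le_left _ _
  have hRNR : RN ≤ R₀ / 2 := by rw [hRN]; exact min_le_right _ _
  obtain ⟨Tm, hTm⟩ : ∃ Tm : ℝ, Tm = min RN R₁ := ⟨_, rfl⟩
  have hTm0 : 0 < Tm := by rw [hTm]; exact lt_min hRN0 hR₁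
  have hTmRN : Tm ≤ RN := by rw [hTm]; exact min_le_left _ _
  have hTmR₁ : Tm ≤ R₁ := by rw [hTm]; exact min_le_right _ _
  obtain ⟨Kσ, hKσ⟩ : ∃ Kσ : ℝ, Kσ = (1 + Fintype.card (Fin (d + 1) ⊕ Fin (d + 1))) + a₀ * ((Fintype.card ι : ℝ) * (((Fintype.card ι : ℝ) + 2) * (2 * ((d : ℝ) + 1)))) + (2 * ((d : ℝ) + 1)) + 1 := ⟨_, rfl⟩
  have hKσ0 : 0 < Kσ := by rw [hKσ]; positivity
  have hKσ1 : (1 + Fintype.card (Fin (d + 1) ⊕ Fin (d + 1))) + a₀ * ((Fintype.card ι : ℝ) * (((Fintype.card ι : ℝ) + 2) * (2 * ((d : ℝ) + 1)))) + (2 * ((d : ℝ) + 1)) ≤ Kσ := by rw [hKσ]; linarith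
  have hKσ2 : (1 + Fintype.card (Fin (d + 1) ⊕ Fin (d + 1))) ≤ Kσ := by
    have : 0 ≤ a₀ * ((Fintype.card ι : ℝ) * (((Fintype.card ι : ℝ) + 2) * (2 * ((d : ℝ) + 1)))) + (2 * ((d : ℝ) + 1)) := by positivity
    linarith
  have hKσ3 : (2 * ((d : ℝ) + 1)) ≤ Kσ := by
    have : 0 ≤ a₀ * ((Fintype.card ι : ℝ) * (((Fintype.card ι : ℝ) + 2) * (2 * ((d : ℝ) + 1)))) := by positivity
    linarith
  obtain ⟨rV, hrV⟩ : ∃ rV : ℝ, rV = min (1 / (2 * ((d : ℝ) + 1))) (Tm / (3 * (BR + 1) * Kσ)) := ⟨_, rfl⟩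
  have hrV0 : 0 < rV := by rw [hrV]; exact lt_min (by positivity) (by positivity)
  have hrVD : 2 * ((d : ℝ) + 1) * rV ≤ 1 := by
    have h : rV ≤ 1 / (2 * ((d : ℝ) + 1)) := by rw [hrV]; exact min_le_left _ _
    calc (2 * ((d : ℝ) + 1)) * rV ≤ (2 * ((d : ℝ) + 1)) * (1 / (2 * ((d : ℝ) + 1))) := mul_le_mul_of_nonneg_left h hDd0.le
      _ = 1 := by field_simp
  have hrVK : rV * (3 * (BR + 1) * Kσ) ≤ Tm := by
    have h : rV ≤ Tm / (3 * (BR + 1) * Kσ) := by rw [hrV]; exact min_le_right _ _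
    have hpos : 0 < 3 * (BR + 1) * Kσ := by positivity
    calc rV * (3 * (BR + 1) * Kσ) ≤ Tm / (3 * (BR + 1) * Kσ) * (3 * (BR + 1) * Kσ) := mul_le_mul_of_nonneg_right h hpos.le
      _ = Tm := by field_simp
  have hrVKσ : rV * Kσ ≤ Tm / 3 := by
    have h1 : 0 ≤ rV * Kσ := by positivity
    have h2 : 3 * (rV * Kσ) ≤ rV * (3 * (BR + 1) * Kσ) := by nlinarith [h1, hBR.le]
    linarith
  have hrVKσ' : (BR + 1) * (rV * Kσ) ≤ Tm / 3 := by
    have e1 : (BR + 1) * (rV * Kσ) * 3 = rV * (3 * (BR + 1) * Kσ) := by ring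
    linarith [hrVK]
  obtain ⟨Qe, hQe⟩ : ∃ Qe : ℝ, Qe = @basisConst ι _ (Matrix mm mm ℂ) Matrix.frobeniusNormedAddCommGroup Matrix.frobeniusNormedSpace e * (2 * Real.sqrt (Fintype.card mm)) * (Real.sqrt (Fintype.card mm) * 3) := ⟨_, rfl⟩
  have hQe0 : 0 ≤ Qe := by rw [hQe]; positivity
  obtain ⟨P, hP⟩ : ∃ P : ℝ, P = (Fintype.card ι : ℝ) * Qe + (Fintype.card ι : ℝ) * ((Fintype.card (Fin (d + 1)) : ℝ) * ((Fintype.card ι : ℝ) * Qe ^ 2 + Qe)) + 1 := ⟨_, rfl⟩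
  have hP0 : 0 < P := by rw [hP]; positivity
  have hIQP : (Fintype.card ι : ℝ) * Qe ≤ P := by
    have : 0 ≤ (Fintype.card ι : ℝ) * ((Fintype.card (Fin (d + 1)) : ℝ) * ((Fintype.card ι : ℝ) * Qe ^ 2 + Qe)) := by positivity
    linarith
  have hP2 : (Fintype.card ι : ℝ) * ((Fintype.card (Fin (d + 1)) : ℝ) * ((Fintype.card ι : ℝ) * Qe ^ 2 + Qe)) ≤ P := by
    have : 0 ≤ (Fintype.card ι : ℝ) * Qe := by positivity
    linarith
  obtain ⟨Kq, hKq⟩ : ∃ Kq : ℝ, Kq = |a| * (3 * ((2 * ((d : ℝ) + 2)) * ((Fintype.card ι : ℝ) * Qe))) * Bq + 1 := ⟨_, rfl⟩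
  have hKq0 : 0 < Kq := by rw [hKq]; positivity
  have hKq1 : |a| * (3 * ((2 * ((d : ℝ) + 2)) * ((Fintype.card ι : ℝ) * Qe))) * Bq ≤ Kq := by linarith
  obtain ⟨ε₀, hε⟩ : ∃ ε₀ : ℝ, ε₀ = min 1 (min (1 / ((2 * ((d : ℝ) + 2)) * ((Fintype.card ι : ℝ) * Qe) + 1)) (min (rV / P) (RN / (3 * Kq)))) := ⟨_, rfl⟩
  have hε0 : 0 < ε₀ := by rw [hε]; exact lt_min one_pos (lt_min (by positivity) (lt_min (by positivity) (by positivity)))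
  have hε1 : ε₀ ≤ 1 := by rw [hε]; exact min_le_left _ _
  have hεD : (2 * ((d : ℝ) + 2)) * ((Fintype.card ι : ℝ) * Qe) * ε₀ ≤ 1 := by
    have h : ε₀ ≤ 1 / ((2 * ((d : ℝ) + 2)) * ((Fintype.card ι : ℝ) * Qe) + 1) := by rw [hε]; exact (min_le_right _ _).trans (min_le_left _ _)
    have hpos : 0 < (2 * ((d : ℝ) + 2)) * ((Fintype.card ι : ℝ) * Qe) + 1 := by positivity
    have h2 : ε₀ * ((2 * ((d : ℝ) + 2)) * ((Fintype.card ι : ℝ) * Qe) + 1) ≤ 1 := by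
      calc ε₀ * ((2 * ((d : ℝ) + 2)) * ((Fintype.card ι : ℝ) * Qe) + 1) ≤ 1 / ((2 * ((d : ℝ) + 2)) * ((Fintype.card ι : ℝ) * Qe) + 1) * ((2 * ((d : ℝ) + 2)) * ((Fintype.card ι : ℝ) * Qe) + 1) := mul_le_mul_of_nonneg_right h hpos.le
        _ = 1 := by field_simp
    nlinarith [h2, hε0.le]
  have hεP : P * ε₀ ≤ rV := by
    have h : ε₀ ≤ rV / P := by rw [hε]; exact ((min_le_right _ _).trans (min_le_right _ _)).trans (min_le_left _ _)
    calc P * ε₀ ≤ P * (rV / P) := mul_le_mul_of_nonneg_left h hP0.le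
      _ = rV := by field_simp
  have hεQ : Kq * ε₀ ≤ RN / 3 := by
    have h : ε₀ ≤ RN / (3 * Kq) := by rw [hε]; exact ((min_le_right _ _).trans (min_le_right _ _)).trans (min_le_right _ _)
    calc Kq * ε₀ ≤ Kq * (RN / (3 * Kq)) := mul_le_mul_of_nonneg_left h hKq0.le
      _ = RN / 3 := by field_simp
  obtain ⟨w₂, hw₂⟩ : ∃ w₂ : ℝ, w₂ = max w₀ (max 1 (3 * (BR + 1) * (1 + 2 / δR) / Tm)) := ⟨_, rfl⟩
  have hw₂0 : w₀ ≤ w₂ := by rw [hw₂]; exact le_max_left _ _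
  have hw₂1 : 1 ≤ w₂ := by rw [hw₂]; exact (le_max_left _ _).trans (le_max_right _ _)
  have hw₂T : 3 * (BR + 1) * (1 + 2 / δR) / Tm ≤ w₂ := by rw [hw₂]; exact (le_max_right _ _).trans (le_max_right _ _)
  refine ⟨ε₀, w₂, hε0, fun mv kk hk hw => ?_⟩
  intro U hU ξ C hξ hC hs hs2 w hwU hdat
  have hw0 : w₀ ≤ ((L ^ mv : ℕ) : ℝ) := hw₂0.trans hw
  -- the scale letters at this cover index
  have hwv1 : 1 ≤ ((L ^ mv : ℕ) : ℝ) := hw₂1.trans hw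
  have hwv0 : 0 < ((L ^ mv : ℕ) : ℝ) := lt_of_lt_of_le one_pos hwv1
  have hnpos : 0 < L ^ kk := pow_pos (Nat.pos_of_ne_zero (NeZero.ne L)) kk
  have hnr : (0 : ℝ) < ((L ^ kk : ℕ) : ℝ) := by exact_mod_cast hnpos
  have hn1 : (1 : ℝ) ≤ ((L ^ kk : ℕ) : ℝ) := by exact_mod_cast hnpos
  have hη0 : 0 ≤ ((((L ^ kk : ℕ) : ℝ))⁻¹) := by positivity
  have hη1 : ((((L ^ kk : ℕ) : ℝ))⁻¹) ≤ 1 := inv_le_one_of_one_le₀ hn1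
  have hs0 : 0 ≤ (C / ξ) := by positivity
  have hs1 : (C / ξ) ≤ 1 := hs.trans hε1
  have hs20 : 0 ≤ (C / ξ ^ 2) := by positivity
  -- `e^{ηC∕ξ} ≤ 3`; the one-bond letter `Y ≤ Q_e·(C∕ξ)`, the adjoint-shape letter `Y₂ ≤ Q_e·(C∕ξ²)`
  have hE3 : Real.exp (((((L ^ kk : ℕ) : ℝ))⁻¹) * (C / ξ)) ≤ 3 := by
    calc Real.exp (((((L ^ kk : ℕ) : ℝ))⁻¹) * (C / ξ)) ≤ Real.exp 1 := Real.exp_le_exp.mpr (mul_le_one₀ hη1 hs0 hs1)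
      _ ≤ 3 := by have := Real.exp_one_lt_d9; linarith only [this]
  have hY0 : 0 ≤ @basisConst ι _ (Matrix mm mm ℂ) Matrix.frobeniusNormedAddCommGroup Matrix.frobeniusNormedSpace e * (2 * Real.sqrt (Fintype.card mm)) * (Real.sqrt (Fintype.card mm) * ((C / ξ) * Real.exp (((((L ^ kk : ℕ) : ℝ))⁻¹) * (C / ξ)))) := by positivity
  have hYle : @basisConst ι _ (Matrix mm mm ℂ) Matrix.frobeniusNormedAddCommGroup Matrix.frobeniusNormedSpace e * (2 * Real.sqrt (Fintype.card mm)) * (Real.sqrt (Fintype.card mm) * ((C / ξ) * Real.exp (((((L ^ kk : ℕ) : ℝ))⁻¹) * (C / ξ)))) ≤ Qe * (C / ξ) := by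
    rw [hQe]
    calc @basisConst ι _ (Matrix mm mm ℂ) Matrix.frobeniusNormedAddCommGroup Matrix.frobeniusNormedSpace e * (2 * Real.sqrt (Fintype.card mm)) * (Real.sqrt (Fintype.card mm) * ((C / ξ) * Real.exp (((((L ^ kk : ℕ) : ℝ))⁻¹) * (C / ξ)))) ≤ @basisConst ι _ (Matrix mm mm ℂ) Matrix.frobeniusNormedAddCommGroup Matrix.frobeniusNormedSpace e * (2 * Real.sqrt (Fintype.card mm)) * (Real.sqrt (Fintype.card mm) * ((C / ξ) * 3)) := by gcongr
      _ = @basisConst ι _ (Matrix mm mm ℂ) Matrix.frobeniusNormedAddCommGroup Matrix.frobeniusNormedSpace e * (2 * Real.sqrt (Fintype.card mm)) * (Real.sqrt (Fintype.card mm) * 3) * (C / ξ) := by ring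
  have hIY : (Fintype.card ι : ℝ) * (@basisConst ι _ (Matrix mm mm ℂ) Matrix.frobeniusNormedAddCommGroup Matrix.frobeniusNormedSpace e * (2 * Real.sqrt (Fintype.card mm)) * (Real.sqrt (Fintype.card mm) * ((C / ξ) * Real.exp (((((L ^ kk : ℕ) : ℝ))⁻¹) * (C / ξ))))) ≤ (Fintype.card ι : ℝ) * Qe * ε₀ := by
    calc (Fintype.card ι : ℝ) * (@basisConst ι _ (Matrix mm mm ℂ) Matrix.frobeniusNormedAddCommGroup Matrix.frobeniusNormedSpace e * (2 * Real.sqrt (Fintype.card mm)) * (Real.sqrt (Fintype.card mm) * ((C / ξ) * Real.exp (((((L ^ kk : ℕ) : ℝ))⁻¹) * (C / ξ))))) ≤ (Fintype.card ι : ℝ) * (Qe * (C / ξ)) := mul_le_mul_of_nonneg_left hYle hI0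
      _ = (Fintype.card ι : ℝ) * Qe * (C / ξ) := by ring
      _ ≤ (Fintype.card ι : ℝ) * Qe * ε₀ := mul_le_mul_of_nonneg_left hs (by positivity)
  have hIY0 : 0 ≤ (Fintype.card ι : ℝ) * (@basisConst ι _ (Matrix mm mm ℂ) Matrix.frobeniusNormedAddCommGroup Matrix.frobeniusNormedSpace e * (2 * Real.sqrt (Fintype.card mm)) * (Real.sqrt (Fintype.card mm) * ((C / ξ) * Real.exp (((((L ^ kk : ℕ) : ℝ))⁻¹) * (C / ξ))))) := by positivity
  have hY2le : @basisConst ι _ (Matrix mm mm ℂ) Matrix.frobeniusNormedAddCommGroup Matrix.frobeniusNormedSpace e * (2 * Real.sqrt (Fintype.card mm)) * (Real.sqrt (Fintype.card mm) * ((C / ξ ^ 2) * Real.exp (((((L ^ kk : ℕ) : ℝ))⁻¹) * (C / ξ)))) ≤ Qe * ε₀ := by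
    rw [hQe]
    calc @basisConst ι _ (Matrix mm mm ℂ) Matrix.frobeniusNormedAddCommGroup Matrix.frobeniusNormedSpace e * (2 * Real.sqrt (Fintype.card mm)) * (Real.sqrt (Fintype.card mm) * ((C / ξ ^ 2) * Real.exp (((((L ^ kk : ℕ) : ℝ))⁻¹) * (C / ξ)))) ≤ @basisConst ι _ (Matrix mm mm ℂ) Matrix.frobeniusNormedAddCommGroup Matrix.frobeniusNormedSpace e * (2 * Real.sqrt (Fintype.card mm)) * (Real.sqrt (Fintype.card mm) * ((C / ξ ^ 2) * 3)) := by gcongr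
      _ = @basisConst ι _ (Matrix mm mm ℂ) Matrix.frobeniusNormedAddCommGroup Matrix.frobeniusNormedSpace e * (2 * Real.sqrt (Fintype.card mm)) * (Real.sqrt (Fintype.card mm) * 3) * (C / ξ ^ 2) := by ring
      _ ≤ @basisConst ι _ (Matrix mm mm ℂ) Matrix.frobeniusNormedAddCommGroup Matrix.frobeniusNormedSpace e * (2 * Real.sqrt (Fintype.card mm)) * (Real.sqrt (Fintype.card mm) * 3) * ε₀ := mul_le_mul_of_nonneg_left hs2 (by positivity)
  -- `σ = (1 + r_V n⁻¹)^{(d+1)n} − 1 ≤ 2(d+1)r_V ≤ 1`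
  obtain ⟨hσ0, hσle, hσ1⟩ := sigma_le_of_small d (L ^ kk) hnpos hrV0.le hrVD
  have hσD : ((1 + rV * ((((L ^ kk : ℕ) : ℝ))⁻¹)) ^ ((d + 1) * L ^ kk) - 1) ≤ (2 * ((d : ℝ) + 1)) * rV := by linarith only [hσle]
  have hσ2 : Fintype.card ι * ((1 + rV * ((((L ^ kk : ℕ) : ℝ))⁻¹)) ^ ((d + 1) * L ^ kk) - 1) ^ 2 + 2 * ((1 + rV * ((((L ^ kk : ℕ) : ℝ))⁻¹)) ^ ((d + 1) * L ^ kk) - 1) ≤ ((Fintype.card ι : ℝ) + 2) * ((2 * ((d : ℝ) + 1)) * rV) := by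
    have h1 : ((1 + rV * ((((L ^ kk : ℕ) : ℝ))⁻¹)) ^ ((d + 1) * L ^ kk) - 1) ^ 2 ≤ ((1 + rV * ((((L ^ kk : ℕ) : ℝ))⁻¹)) ^ ((d + 1) * L ^ kk) - 1) := by nlinarith only [hσ0, hσ1]
    calc Fintype.card ι * ((1 + rV * ((((L ^ kk : ℕ) : ℝ))⁻¹)) ^ ((d + 1) * L ^ kk) - 1) ^ 2 + 2 * ((1 + rV * ((((L ^ kk : ℕ) : ℝ))⁻¹)) ^ ((d + 1) * L ^ kk) - 1) ≤ Fintype.card ι * ((1 + rV * ((((L ^ kk : ℕ) : ℝ))⁻¹)) ^ ((d + 1) * L ^ kk) - 1) + 2 * ((1 + rV * ((((L ^ kk : ℕ) : ℝ))⁻¹)) ^ ((d + 1) * L ^ kk) - 1) := by gcongr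
      _ = ((Fintype.card ι : ℝ) + 2) * ((1 + rV * ((((L ^ kk : ℕ) : ℝ))⁻¹)) ^ ((d + 1) * L ^ kk) - 1) := by ring
      _ ≤ ((Fintype.card ι : ℝ) + 2) * ((2 * ((d : ℝ) + 1)) * rV) := mul_le_mul_of_nonneg_left hσD (by positivity)
  have hσ20 : 0 ≤ Fintype.card ι * ((1 + rV * ((((L ^ kk : ℕ) : ℝ))⁻¹)) ^ ((d + 1) * L ^ kk) - 1) ^ 2 + 2 * ((1 + rV * ((((L ^ kk : ℕ) : ℝ))⁻¹)) ^ ((d + 1) * L ^ kk) - 1) := by positivity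
  -- `K = (1 + ρ)^{(d+2)n} − 1 ≤ 2(d+2)·(|ι|·Y) ≤ 1` with `ρ = (|ι|·Y)·n⁻¹`
  have hρ : Fintype.card ι * (@basisConst ι _ (Matrix mm mm ℂ) Matrix.frobeniusNormedAddCommGroup Matrix.frobeniusNormedSpace e * (2 * Real.sqrt (Fintype.card mm)) * (Real.sqrt (Fintype.card mm) * (((((L ^ kk : ℕ) : ℝ))⁻¹) * (C / ξ) * Real.exp (((((L ^ kk : ℕ) : ℝ))⁻¹) * (C / ξ))))) = (Fintype.card ι : ℝ) * (@basisConst ι _ (Matrix mm mm ℂ) Matrix.frobeniusNormedAddCommGroup Matrix.frobeniusNormedSpace e * (2 * Real.sqrt (Fintype.card mm)) * (Real.sqrt (Fintype.card mm) * ((C / ξ) * Real.exp (((((L ^ kk : ℕ) : ℝ))⁻¹) * (C / ξ))))) * ((((L ^ kk : ℕ) : ℝ))⁻¹) := by ring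
  have hsmallK : 2 * (((d + 2 : ℕ)) : ℝ) * ((Fintype.card ι : ℝ) * (@basisConst ι _ (Matrix mm mm ℂ) Matrix.frobeniusNormedAddCommGroup Matrix.frobeniusNormedSpace e * (2 * Real.sqrt (Fintype.card mm)) * (Real.sqrt (Fintype.card mm) * ((C / ξ) * Real.exp (((((L ^ kk : ℕ) : ℝ))⁻¹) * (C / ξ)))))) ≤ 1 := by
    have e1 : 2 * (((d + 2 : ℕ)) : ℝ) * ((Fintype.card ι : ℝ) * (@basisConst ι _ (Matrix mm mm ℂ) Matrix.frobeniusNormedAddCommGroup Matrix.frobeniusNormedSpace e * (2 * Real.sqrt (Fintype.card mm)) * (Real.sqrt (Fintype.card mm) * ((C / ξ) * Real.exp (((((L ^ kk : ℕ) : ℝ))⁻¹) * (C / ξ)))))) = (2 * ((d : ℝ) + 2)) * ((Fintype.card ι : ℝ) * (@basisConst ι _ (Matrix mm mm ℂ) Matrix.frobeniusNormedAddCommGroup Matrix.frobeniusNormedSpace e * (2 * Real.sqrt (Fintype.card mm)) * (Real.sqrt (Fintype.card mm) * ((C / ξ) * Real.exp (((((L ^ kk : ℕ) : ℝ))⁻¹)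 * (C / ξ)))))) := by push_cast; ring
    rw [e1]
    calc (2 * ((d : ℝ) + 2)) * ((Fintype.card ι : ℝ) * (@basisConst ι _ (Matrix mm mm ℂ) Matrix.frobeniusNormedAddCommGroup Matrix.frobeniusNormedSpace e * (2 * Real.sqrt (Fintype.card mm)) * (Real.sqrt (Fintype.card mm) * ((C / ξ) * Real.exp (((((L ^ kk : ℕ) : ℝ))⁻¹) * (C / ξ)))))) ≤ (2 * ((d : ℝ) + 2)) * ((Fintype.card ι : ℝ) * Qe * ε₀) := mul_le_mul_of_nonneg_left hIY hD20.le
      _ = (2 * ((d : ℝ) + 2)) * ((Fintype.card ι : ℝ) * Qe) * ε₀ := by ring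
      _ ≤ 1 := hεD
  obtain ⟨hK0, hKle, hK1⟩ := pow_mul_sub_one_le_of_small (d + 2) (L ^ kk) hnpos hIY0 hsmallK
  have hKD : ((1 + Fintype.card ι * (@basisConst ι _ (Matrix mm mm ℂ) Matrix.frobeniusNormedAddCommGroup Matrix.frobeniusNormedSpace e * (2 * Real.sqrt (Fintype.card mm)) * (Real.sqrt (Fintype.card mm) * ((C / ξ) * Real.exp (((((L ^ kk : ℕ) : ℝ))⁻¹) * (C / ξ))))) * ((((L ^ kk : ℕ) : ℝ))⁻¹)) ^ ((d + 2) * L ^ kk) - 1) ≤ (2 * ((d : ℝ) + 2)) * ((Fintype.card ι : ℝ) * Qe) * ε₀ := by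
    have e1 : 2 * ((((d + 2 : ℕ)) : ℝ) * ((Fintype.card ι : ℝ) * (@basisConst ι _ (Matrix mm mm ℂ) Matrix.frobeniusNormedAddCommGroup Matrix.frobeniusNormedSpace e * (2 * Real.sqrt (Fintype.card mm)) * (Real.sqrt (Fintype.card mm) * ((C / ξ) * Real.exp (((((L ^ kk : ℕ) : ℝ))⁻¹) * (C / ξ))))))) = (2 * ((d : ℝ) + 2)) * ((Fintype.card ι : ℝ) * (@basisConst ι _ (Matrix mm mm ℂ) Matrix.frobeniusNormedAddCommGroup Matrix.frobeniusNormedSpace e * (2 * Real.sqrt (Fintype.card mm)) * (Real.sqrt (Fintype.card mm) * ((C / ξ) * Real.exp (((((L ^ kk : ℕ) : ℝ))⁻¹) * (C / ξ)))))) := by push_cast; ring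
    have h1 : ((1 + Fintype.card ι * (@basisConst ι _ (Matrix mm mm ℂ) Matrix.frobeniusNormedAddCommGroup Matrix.frobeniusNormedSpace e * (2 * Real.sqrt (Fintype.card mm)) * (Real.sqrt (Fintype.card mm) * ((C / ξ) * Real.exp (((((L ^ kk : ℕ) : ℝ))⁻¹) * (C / ξ))))) * ((((L ^ kk : ℕ) : ℝ))⁻¹)) ^ ((d + 2) * L ^ kk) - 1) ≤ (2 * ((d : ℝ) + 2)) * ((Fintype.card ι : ℝ) * (@basisConst ι _ (Matrix mm mm ℂ) Matrix.frobeniusNormedAddCommGroup Matrix.frobeniusNormedSpace e * (2 * Real.sqrt (Fintype.card mm)) * (Real.sqrt (Fintype.card mm) * ((C / ξ) * Real.exp (((((L ^ kk : ℕ) : ℝ))⁻¹) * (C / ξ)))))) := by rw [← e1]; exact hKle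
    calc ((1 + Fintype.card ι * (@basisConst ι _ (Matrix mm mm ℂ) Matrix.frobeniusNormedAddCommGroup Matrix.frobeniusNormedSpace e * (2 * Real.sqrt (Fintype.card mm)) * (Real.sqrt (Fintype.card mm) * ((C / ξ) * Real.exp (((((L ^ kk : ℕ) : ℝ))⁻¹) * (C / ξ))))) * ((((L ^ kk : ℕ) : ℝ))⁻¹)) ^ ((d + 2) * L ^ kk) - 1) ≤ (2 * ((d : ℝ) + 2)) * ((Fintype.card ι : ℝ) * (@basisConst ι _ (Matrix mm mm ℂ) Matrix.frobeniusNormedAddCommGroup Matrix.frobeniusNormedSpace e * (2 * Real.sqrt (Fintype.card mm)) * (Real.sqrt (Fintype.card mm) * ((C / ξ) * Real.exp (((((L ^ kk : ℕ) : ℝ))⁻¹) * (C / ξ)))))) := h1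
      _ ≤ (2 * ((d : ℝ) + 2)) * ((Fintype.card ι : ℝ) * Qe * ε₀) := mul_le_mul_of_nonneg_left hIY hD20.le
      _ = (2 * ((d : ℝ) + 2)) * ((Fintype.card ι : ℝ) * Qe) * ε₀ := by ring
  have eK : ((1 + Fintype.card ι * (@basisConst ι _ (Matrix mm mm ℂ) Matrix.frobeniusNormedAddCommGroup Matrix.frobeniusNormedSpace e * (2 * Real.sqrt (Fintype.card mm)) * (Real.sqrt (Fintype.card mm) * (((((L ^ kk : ℕ) : ℝ))⁻¹) * (C / ξ) * Real.exp (((((L ^ kk : ℕ) : ℝ))⁻¹) * (C / ξ)))))) ^ ((d + 2) * L ^ kk) - 1) = ((1 + Fintype.card ι * (@basisConst ι _ (Matrix mm mm ℂ) Matrix.frobeniusNormedAddCommGroup Matrix.frobeniusNormedSpace e * (2 * Real.sqrt (Fintype.card mm)) * (Real.sqrt (Fintype.card mm) * ((C / ξ) * Real.exp (((((L ^ kk : ℕ) : ℝ))⁻¹) * (C / ξ))))) * ((((L ^ kk : ℕ) : ℝ))⁻¹)) ^ ((d + 2) * L ^ kk) - 1) := by rw [hρ]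
  -- King's mass letter; the tail in the scale `w = L^m`
  have haK0 : 0 < aK a₀ (L : ℝ) kk := aK_pos ha₀ hL1r hk
  have haK1 : aK a₀ (L : ℝ) kk ≤ a₀ := aK_le ha₀ hL1r hk
  have htail : (((L ^ mv : ℕ) : ℝ))⁻¹ + 2 * Real.exp (-(δR * ((L ^ mv : ℕ) : ℝ))) ≤ (1 + 2 / δR) / ((L ^ mv : ℕ) : ℝ) := by
    have h1 : Real.exp (-(δR * ((L ^ mv : ℕ) : ℝ))) ≤ (δR * ((L ^ mv : ℕ) : ℝ))⁻¹ := by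
      rw [Real.exp_neg]
      have h2 : δR * ((L ^ mv : ℕ) : ℝ) + 1 ≤ Real.exp (δR * ((L ^ mv : ℕ) : ℝ)) := Real.add_one_le_exp _
      have h3 : 0 < δR * ((L ^ mv : ℕ) : ℝ) := by positivity
      exact inv_anti₀ h3 (by linarith only [h2])
    have e1 : (1 + 2 / δR) / ((L ^ mv : ℕ) : ℝ) = (((L ^ mv : ℕ) : ℝ))⁻¹ + 2 * (δR * ((L ^ mv : ℕ) : ℝ))⁻¹ := by
      rw [add_div, one_div, div_div, div_eq_mul_inv]
    rw [e1]; linarith only [h1]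
  have htailT : BR * ((((L ^ mv : ℕ) : ℝ))⁻¹ + 2 * Real.exp (-(δR * ((L ^ mv : ℕ) : ℝ)))) ≤ Tm / 3 := by
    have hq0 : 0 ≤ (1 + 2 / δR) / ((L ^ mv : ℕ) : ℝ) := by positivity
    have h1 : BR * ((((L ^ mv : ℕ) : ℝ))⁻¹ + 2 * Real.exp (-(δR * ((L ^ mv : ℕ) : ℝ)))) ≤ (BR + 1) * ((1 + 2 / δR) / ((L ^ mv : ℕ) : ℝ)) :=
      (mul_le_mul_of_nonneg_left htail hBR.le).trans (mul_le_mul_of_nonneg_right (by linarith only [hBR]) hq0)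
    have h2 : 3 * (BR + 1) * (1 + 2 / δR) / Tm ≤ ((L ^ mv : ℕ) : ℝ) := hw₂T.trans hw
    have h3 : 3 * (BR + 1) * (1 + 2 / δR) ≤ ((L ^ mv : ℕ) : ℝ) * Tm := (div_le_iff₀ hTm0).mp h2
    have h4 : (BR + 1) * ((1 + 2 / δR) / ((L ^ mv : ℕ) : ℝ)) ≤ Tm / 3 := by
      rw [mul_div_assoc', div_le_iff₀ hwv0]
      linarith only [h3]
    exact h1.trans h4
  -- THE SEVEN DISPLAYED INEQUALITIES of n15-c∕319
  have hG1 : Fintype.card ι * (@basisConst ι _ (Matrix mm mm ℂ) Matrix.frobeniusNormedAddCommGroup Matrix.frobeniusNormedSpace e * (2 * Real.sqrt (Fintype.card mm)) * (Real.sqrt (Fintype.card mm) * ((C / ξ) * Real.exp (((((L ^ kk : ℕ) : ℝ))⁻¹) * (C / ξ))))) ≤ rV := by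
    calc (Fintype.card ι : ℝ) * (@basisConst ι _ (Matrix mm mm ℂ) Matrix.frobeniusNormedAddCommGroup Matrix.frobeniusNormedSpace e * (2 * Real.sqrt (Fintype.card mm)) * (Real.sqrt (Fintype.card mm) * ((C / ξ) * Real.exp (((((L ^ kk : ℕ) : ℝ))⁻¹) * (C / ξ))))) ≤ (Fintype.card ι : ℝ) * Qe * ε₀ := hIY
      _ ≤ P * ε₀ := mul_le_mul_of_nonneg_right hIQP hε0.le
      _ ≤ rV := hεP
  have hG2 : Fintype.card ι * (Fintype.card (Fin (d + 1)) * (Fintype.card ι * (@basisConst ι _ (Matrix mm mm ℂ) Matrix.frobeniusNormedAddCommGroup Matrix.frobeniusNormedSpace e * (2 * Real.sqrt (Fintype.card mm)) * (Real.sqrt (Fintype.card mm) * ((C / ξ) * Real.exp (((((L ^ kk : ℕ) : ℝ))⁻¹) * (C / ξ))))) ^ 2 + @basisConst ι _ (Matrix mm mm ℂ) Matrix.frobeniusNormedAddCommGroup Matrix.frobeniusNormedSpace e * (2 * Real.sqrt (Fintype.card mm)) * (Real.sqrt (Fintype.card mm) * ((C / ξ ^ 2) * Real.exp (((((L ^ kk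 : ℕ) : ℝ))⁻¹) * (C / ξ)))))) ≤ rV := by
    have h1 : (@basisConst ι _ (Matrix mm mm ℂ) Matrix.frobeniusNormedAddCommGroup Matrix.frobeniusNormedSpace e * (2 * Real.sqrt (Fintype.card mm)) * (Real.sqrt (Fintype.card mm) * ((C / ξ) * Real.exp (((((L ^ kk : ℕ) : ℝ))⁻¹) * (C / ξ))))) ^ 2 ≤ Qe ^ 2 * ε₀ := by
      have h2 : (@basisConst ι _ (Matrix mm mm ℂ) Matrix.frobeniusNormedAddCommGroup Matrix.frobeniusNormedSpace e * (2 * Real.sqrt (Fintype.card mm)) * (Real.sqrt (Fintype.card mm) * ((C / ξ) * Real.exp (((((L ^ kk : ℕ) : ℝ))⁻¹) * (C / ξ))))) ^ 2 ≤ (Qe * (C / ξ)) ^ 2 := pow_le_pow_left₀ hY0 hYle 2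
      have h3 : (Qe * (C / ξ)) ^ 2 = Qe ^ 2 * ((C / ξ) * (C / ξ)) := by ring
      have h4 : (C / ξ) * (C / ξ) ≤ ε₀ := (mul_le_mul_of_nonneg_left hs1 hs0).trans (by rw [mul_one]; exact hs)
      calc (@basisConst ι _ (Matrix mm mm ℂ) Matrix.frobeniusNormedAddCommGroup Matrix.frobeniusNormedSpace e * (2 * Real.sqrt (Fintype.card mm)) * (Real.sqrt (Fintype.card mm) * ((C / ξ) * Real.exp (((((L ^ kk : ℕ) : ℝ))⁻¹) * (C / ξ))))) ^ 2 ≤ Qe ^ 2 * ((C / ξ) * (C / ξ)) := by rw [← h3]; exact h2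
        _ ≤ Qe ^ 2 * ε₀ := mul_le_mul_of_nonneg_left h4 (sq_nonneg _)
    calc Fintype.card ι * (Fintype.card (Fin (d + 1)) * (Fintype.card ι * (@basisConst ι _ (Matrix mm mm ℂ) Matrix.frobeniusNormedAddCommGroup Matrix.frobeniusNormedSpace e * (2 * Real.sqrt (Fintype.card mm)) * (Real.sqrt (Fintype.card mm) * ((C / ξ) * Real.exp (((((L ^ kk : ℕ) : ℝ))⁻¹) * (C / ξ))))) ^ 2 + @basisConst ι _ (Matrix mm mm ℂ) Matrix.frobeniusNormedAddCommGroup Matrix.frobeniusNormedSpace e * (2 * Real.sqrt (Fintype.card mm)) * (Real.sqrt (Fintype.card mm) * ((C / ξ ^ 2) * Real.exp (((((L ^ kk : ℕ) : ℝ))⁻¹) * (C / ξ))))))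
        ≤ (Fintype.card ι : ℝ) * ((Fintype.card (Fin (d + 1)) : ℝ) * ((Fintype.card ι : ℝ) * (Qe ^ 2 * ε₀) + Qe * ε₀)) := by gcongr
      _ = ((Fintype.card ι : ℝ) * ((Fintype.card (Fin (d + 1)) : ℝ) * ((Fintype.card ι : ℝ) * Qe ^ 2 + Qe))) * ε₀ := by ring
      _ ≤ P * ε₀ := mul_le_mul_of_nonneg_right hP2 hε0.le
      _ ≤ rV := hεP
  have hG3 : rV * (1 + Fintype.card (Fin (d + 1) ⊕ Fin (d + 1))) + a₀ * (Fintype.card ι * (Fintype.card ι * ((1 + rV * ((((L ^ kk : ℕ) : ℝ))⁻¹)) ^ ((d + 1) * L ^ kk) - 1) ^ 2 + 2 * ((1 + rV * ((((L ^ kk : ℕ) : ℝ))⁻¹)) ^ ((d + 1) * L ^ kk) - 1))) ≤ R₁ := by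
    calc rV * (1 + Fintype.card (Fin (d + 1) ⊕ Fin (d + 1))) + a₀ * (Fintype.card ι * (Fintype.card ι * ((1 + rV * ((((L ^ kk : ℕ) : ℝ))⁻¹)) ^ ((d + 1) * L ^ kk) - 1) ^ 2 + 2 * ((1 + rV * ((((L ^ kk : ℕ) : ℝ))⁻¹)) ^ ((d + 1) * L ^ kk) - 1))) ≤ rV * (1 + Fintype.card (Fin (d + 1) ⊕ Fin (d + 1))) + a₀ * ((Fintype.card ι : ℝ) * (((Fintype.card ι : ℝ) + 2) * ((2 * ((d : ℝ) + 1)) * rV))) := by gcongr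
      _ = rV * ((1 + Fintype.card (Fin (d + 1) ⊕ Fin (d + 1))) + a₀ * ((Fintype.card ι : ℝ) * (((Fintype.card ι : ℝ) + 2) * (2 * ((d : ℝ) + 1))))) := by ring
      _ ≤ rV * Kσ := mul_le_mul_of_nonneg_left (by linarith only [hKσ1, hDd0]) hrV0.le
      _ ≤ Tm / 3 := hrVKσ
      _ ≤ R₁ := by linarith only [hTmR₁, hTm0]
  have hG4 : ((1 + rV * ((((L ^ kk : ℕ) : ℝ))⁻¹)) ^ ((d + 1) * L ^ kk) - 1) ≤ R₁ := by
    calc ((1 + rV * ((((L ^ kk : ℕ) : ℝ))⁻¹)) ^ ((d + 1) * L ^ kk) - 1) ≤ (2 * ((d : ℝ) + 1)) * rV := hσD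
      _ = rV * (2 * ((d : ℝ) + 1)) := mul_comm _ _
      _ ≤ rV * Kσ := mul_le_mul_of_nonneg_left hKσ3 hrV0.le
      _ ≤ Tm / 3 := hrVKσ
      _ ≤ R₁ := by linarith only [hTmR₁, hTm0]
  have hG5 : |a| * (((1 + Fintype.card ι * (@basisConst ι _ (Matrix mm mm ℂ) Matrix.frobeniusNormedAddCommGroup Matrix.frobeniusNormedSpace e * (2 * Real.sqrt (Fintype.card mm)) * (Real.sqrt (Fintype.card mm) * (((((L ^ kk : ℕ) : ℝ))⁻¹) * (C / ξ) * Real.exp (((((L ^ kk : ℕ) : ℝ))⁻¹) * (C / ξ)))))) ^ ((d + 2) * L ^ kk) - 1) * (2 + ((1 + Fintype.card ι * (@basisConst ι _ (Matrix mm mm ℂ) Matrix.frobeniusNormedAddCommGroup Matrix.frobeniusNormedSpace e * (2 * Real.sqrt (Fintype.card mm)) * (Real.sqrt (Fintype.card mm) * (((((L ^ kk : ℕ) : ℝ))⁻¹) * (C / ξ) * Real.exp (((((L ^ kk : ℕ) : ℝ))⁻¹) * (C / ξ)))))) ^ ((d + 2) * L ^ kk) - 1)) * Bq) + BR * (rV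 * (1 + Fintype.card (Fin (d + 1) ⊕ Fin (d + 1))) + aK a₀ (L : ℝ) kk * (Fintype.card ι * (Fintype.card ι * ((1 + rV * ((((L ^ kk : ℕ) : ℝ))⁻¹)) ^ ((d + 1) * L ^ kk) - 1) ^ 2 + 2 * ((1 + rV * ((((L ^ kk : ℕ) : ℝ))⁻¹)) ^ ((d + 1) * L ^ kk) - 1))) + ((1 + rV * ((((L ^ kk : ℕ) : ℝ))⁻¹)) ^ ((d + 1) * L ^ kk) - 1) + (((L ^ mv : ℕ) : ℝ))⁻¹ + 2 * Real.exp (-(δR * ((L ^ mv : ℕ) : ℝ)))) ≤ RN := by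
    rw [eK]
    have hQ : |a| * (((1 + Fintype.card ι * (@basisConst ι _ (Matrix mm mm ℂ) Matrix.frobeniusNormedAddCommGroup Matrix.frobeniusNormedSpace e * (2 * Real.sqrt (Fintype.card mm)) * (Real.sqrt (Fintype.card mm) * ((C / ξ) * Real.exp (((((L ^ kk : ℕ) : ℝ))⁻¹) * (C / ξ))))) * ((((L ^ kk : ℕ) : ℝ))⁻¹)) ^ ((d + 2) * L ^ kk) - 1) * (2 + ((1 + Fintype.card ι * (@basisConst ι _ (Matrix mm mm ℂ) Matrix.frobeniusNormedAddCommGroup Matrix.frobeniusNormedSpace e * (2 * Real.sqrt (Fintype.card mm)) * (Real.sqrt (Fintype.card mm) * ((C / ξ) * Real.exp (((((L ^ kk : ℕ) : ℝ))⁻¹) * (C / ξ))))) * ((((L ^ kk : ℕ) : ℝ))⁻¹)) ^ ((d + 2) * L ^ kk) - 1)) * Bq) ≤ RN / 3 := by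
      have h1 : ((1 + Fintype.card ι * (@basisConst ι _ (Matrix mm mm ℂ) Matrix.frobeniusNormedAddCommGroup Matrix.frobeniusNormedSpace e * (2 * Real.sqrt (Fintype.card mm)) * (Real.sqrt (Fintype.card mm) * ((C / ξ) * Real.exp (((((L ^ kk : ℕ) : ℝ))⁻¹) * (C / ξ))))) * ((((L ^ kk : ℕ) : ℝ))⁻¹)) ^ ((d + 2) * L ^ kk) - 1) * (2 + ((1 + Fintype.card ι * (@basisConst ι _ (Matrix mm mm ℂ) Matrix.frobeniusNormedAddCommGroup Matrix.frobeniusNormedSpace e * (2 * Real.sqrt (Fintype.card mm)) * (Real.sqrt (Fintype.card mm) * ((C / ξ) * Real.exp (((((L ^ kk : ℕ) : ℝ))⁻¹) * (C / ξ))))) * ((((L ^ kk : ℕ) : ℝ))⁻¹)) ^ ((d + 2) * L ^ kk) - 1)) ≤ 3 * ((2 * ((d : ℝ) + 2)) * ((Fintype.card ι : ℝ) * Qe) * ε₀) := by nlinarith only [hK0, hK1, hKD]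
      calc |a| * (((1 + Fintype.card ι * (@basisConst ι _ (Matrix mm mm ℂ) Matrix.frobeniusNormedAddCommGroup Matrix.frobeniusNormedSpace e * (2 * Real.sqrt (Fintype.card mm)) * (Real.sqrt (Fintype.card mm) * ((C / ξ) * Real.exp (((((L ^ kk : ℕ) : ℝ))⁻¹) * (C / ξ))))) * ((((L ^ kk : ℕ) : ℝ))⁻¹)) ^ ((d + 2) * L ^ kk) - 1) * (2 + ((1 + Fintype.card ι * (@basisConst ι _ (Matrix mm mm ℂ) Matrix.frobeniusNormedAddCommGroup Matrix.frobeniusNormedSpace e * (2 * Real.sqrt (Fintype.card mm)) * (Real.sqrt (Fintype.card mm) * ((C / ξ) * Real.exp (((((L ^ kk : ℕ) : ℝ))⁻¹) * (C / ξ))))) * ((((L ^ kk : ℕ) : ℝ))⁻¹)) ^ ((d + 2) * L ^ kk) - 1)) * Bq) ≤ |a| * (3 * ((2 * ((d : ℝ) + 2)) * ((Fintype.card ι : ℝ) * Qe) * ε₀) * Bq) := by gcongr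
        _ = (|a| * (3 * ((2 * ((d : ℝ) + 2)) * ((Fintype.card ι : ℝ) * Qe))) * Bq) * ε₀ := by ring
        _ ≤ Kq * ε₀ := mul_le_mul_of_nonneg_right hKq1 hε0.le
        _ ≤ RN / 3 := hεQ
    have hR1 : BR * (rV * (1 + Fintype.card (Fin (d + 1) ⊕ Fin (d + 1))) + aK a₀ (L : ℝ) kk * (Fintype.card ι * (Fintype.card ι * ((1 + rV * ((((L ^ kk : ℕ) : ℝ))⁻¹)) ^ ((d + 1) * L ^ kk) - 1) ^ 2 + 2 * ((1 + rV * ((((L ^ kk : ℕ) : ℝ))⁻¹)) ^ ((d + 1) * L ^ kk) - 1))) + ((1 + rV * ((((L ^ kk : ℕ) : ℝ))⁻¹)) ^ ((d + 1) * L ^ kk) - 1)) ≤ Tm / 3 := by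
      have h1 : aK a₀ (L : ℝ) kk * (Fintype.card ι * (Fintype.card ι * ((1 + rV * ((((L ^ kk : ℕ) : ℝ))⁻¹)) ^ ((d + 1) * L ^ kk) - 1) ^ 2 + 2 * ((1 + rV * ((((L ^ kk : ℕ) : ℝ))⁻¹)) ^ ((d + 1) * L ^ kk) - 1))) ≤ a₀ * ((Fintype.card ι : ℝ) * (((Fintype.card ι : ℝ) + 2) * ((2 * ((d : ℝ) + 1)) * rV))) :=
        mul_le_mul haK1 (mul_le_mul_of_nonneg_left hσ2 hI0) (by positivity) ha₀.le
      calc BR * (rV * (1 + Fintype.card (Fin (d + 1) ⊕ Fin (d + 1))) + aK a₀ (L : ℝ) kk * (Fintype.card ι * (Fintype.card ι * ((1 + rV * ((((L ^ kk : ℕ) : ℝ))⁻¹)) ^ ((d + 1) * L ^ kk) - 1) ^ 2 + 2 * ((1 + rV * ((((L ^ kk : ℕ) : ℝ))⁻¹)) ^ ((d + 1) * L ^ kk) - 1))) + ((1 + rV * ((((L ^ kk : ℕ) : ℝ))⁻¹)) ^ ((d + 1) * L ^ kk) - 1)) ≤ BR * (rV * (1 + Fintype.card (Fin (d + 1) ⊕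 Fin (d + 1))) + a₀ * ((Fintype.card ι : ℝ) * (((Fintype.card ι : ℝ) + 2) * ((2 * ((d : ℝ) + 1)) * rV))) + (2 * ((d : ℝ) + 1)) * rV) := by gcongr
        _ = BR * (rV * ((1 + Fintype.card (Fin (d + 1) ⊕ Fin (d + 1))) + a₀ * ((Fintype.card ι : ℝ) * (((Fintype.card ι : ℝ) + 2) * (2 * ((d : ℝ) + 1)))) + (2 * ((d : ℝ) + 1)))) := by ring
        _ ≤ BR * (rV * Kσ) := mul_le_mul_of_nonneg_left (mul_le_mul_of_nonneg_left hKσ1 hrV0.le) hBR.le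
        _ ≤ (BR + 1) * (rV * Kσ) := mul_le_mul_of_nonneg_right (by linarith only [hBR]) (mul_nonneg hrV0.le hKσ0.le)
        _ ≤ Tm / 3 := hrVKσ'
    have e1 : BR * (rV * (1 + Fintype.card (Fin (d + 1) ⊕ Fin (d + 1))) + aK a₀ (L : ℝ) kk * (Fintype.card ι * (Fintype.card ι * ((1 + rV * ((((L ^ kk : ℕ) : ℝ))⁻¹)) ^ ((d + 1) * L ^ kk) - 1) ^ 2 + 2 * ((1 + rV * ((((L ^ kk : ℕ) : ℝ))⁻¹)) ^ ((d + 1) * L ^ kk) - 1))) + ((1 + rV * ((((L ^ kk : ℕ) : ℝ))⁻¹)) ^ ((d + 1) * L ^ kk) - 1) + (((L ^ mv : ℕ) : ℝ))⁻¹ + 2 * Real.exp (-(δR * ((L ^ mv : ℕ) : ℝ)))) = BR * (rV * (1 + Fintype.card (Fin (d + 1) ⊕ Fin (d + 1))) + aK a₀ (L : ℝ) kk * (Fintype.card ι * (Fintype.card ι * ((1 + rV * ((((L ^ kk : ℕ) : ℝ))⁻¹)) ^ ((d + 1) * L ^ kk) - 1) ^ 2 + 2 * ((1 + rV * ((((L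 ^ kk : ℕ) : ℝ))⁻¹)) ^ ((d + 1) * L ^ kk) - 1))) + ((1 + rV * ((((L ^ kk : ℕ) : ℝ))⁻¹)) ^ ((d + 1) * L ^ kk) - 1)) + BR * ((((L ^ mv : ℕ) : ℝ))⁻¹ + 2 * Real.exp (-(δR * ((L ^ mv : ℕ) : ℝ)))) := by ring
    rw [e1]
    linarith only [hQ, hR1, htailT, hTmRN]
  have hG6 : rV * (1 + Fintype.card (Fin (d + 1) ⊕ Fin (d + 1))) + RN ≤ R₀ := by
    have h1 : rV * (1 + Fintype.card (Fin (d + 1) ⊕ Fin (d + 1))) ≤ rV * Kσ := mul_le_mul_of_nonneg_left hKσ2 hrV0.le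
    linarith only [h1, hrVKσ, hTmRN, hRNR, hR₀.le]
  exact H mv kk hk hw0 e he U hU ξ C hξ hC w hwU hdat rV RN hrV0.le hG1 hG2 hG3 hG4 hG5 hG6 hRNθ

end Summit.QuantumFields.YangMills.BalabanUVNodes.N15.Gluing

end
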